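import Summits.AtomisticToContinuum.Crystallization.Theorems.PerronTransitivityUniformBindingRigidityCohesionB

/-!
# Cohesion of uniformly bound Lennard-Jones configurations, IX: single-site binding at a radius

Helper file (`--supports stmt-AtomisticToContinuum-15099`) of the stub
`stub_noThickHalfSpaceBinding` (= `(NHB-thick)`, the open core of cohesion after parts I–VIII) of
the line `registered` of the crux
`Summit.AtomisticToContinuum.Crystallization.Theses.PerronTransitivity.UniformBindingRigidity`
(item stmt-AtomisticToContinuum-15099).  Reusable single-site infrastructure for local (computer-
assisted or by-hand) certificates at a site `p` of a `δ`-separated `Y ⊆ ℝ³`, in the notation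
`U_Y(p) = Σ'_{q ∈ Y, q ≠ p} V_LJ(dist p q)`, `N_R(p) = #{q ∈ Y ∖ {p} : dist q p ≤ R}`,
`tail(δ, R) = (1/6)·1024/(δ³R³)`:

* §15 the near set `{q ∈ Y ∖ {p} : dist q p ≤ R}` as a `Finset` (`exists_finset_near`), and the
  TWO-SIDED TRUNCATION of a site sum at radius `R`:
  `Σ_{near} V_LJ − tail(δ, R) ≤ U_Y(p)` for `R ≥ δ` (`sum_near_sub_tail_le_tsum`, part II's
  `sum_le_tsum_add_of_far`) and `U_Y(p) ≤ Σ_{near} V_LJ` for `R ≥ 1` (`tsum_le_sum_near`, the far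
  terms are `≤ 0`; tree: `HullBulkOptimal.tsum_site_le_sum_near`);
* §16 the SINGLE-SITE BINDING BOUND `−U_Y(p) ≤ N_R(p)/12 + tail(δ, R)` (`neg_tsum_le_card_add_tail`,
  each near term is `≥ −1/12 = min V_LJ`), the packing count `N_R(p) ≤ (2R/δ + 1)³ − 1` for `p ∈ Y`
  (`card_near_le`, tree: `ncard_ball_le`) and the closed form
  `−U_Y(p) ≤ ((2R/δ + 1)³ − 1)/12 + tail(δ, R)` (`neg_tsum_le_packing_add_tail`);
* §17 the HALF-SPACE refinement: `r`-separated points of `closedBall c R` lying in a closed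
  half-space through `c` number at most `4 (R/r + 1)³` (`card_le_half_of_separated`: the `r/2`-balls
  about them lie in an open half-ball of radius `R + r` about `c + (r/2)u`, whose volume is half the
  ball's by the point reflection `x ↦ 2c' − x`), whence `N_R(0) ≤ 4(R/δ + 1)³ − 1` at the top site
  `0` of a half-space configuration `Y ⊆ {⟪·, u⟫ ≤ 0}` (`card_near_le_half`).

Registered sub-goal proved here: `stub_nhb_siteBindingSplit` (§16 in arrow form).  These bounds are
far from the margin of `(NHB-thick)` at the provable separation `δ = 1/4` (they are the quantitative
reason the single-site route fails, parts II/IV docstrings); they are recorded as the common first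
step of any local certificate.  All `[folklore]`.
-/

noncomputable section

namespace Summit.AtomisticToContinuum.Crystallization.Theorems.PerronTransitivityUniformBindingRigidity

open scoped BigOperators Topology ENNReal
open Filter Set Metric MeasureTheory
open Literature.MathematicalPhysics.StatisticalMechanics
open Summit.AtomisticToContinuum.Crystallization.Theorems.ChargedEnergyGapNegative (E3)
open Summit.AtomisticToContinuum.Crystallization.Theorems.HullBulkOptimal
  (tsum_site_le_sum_near ncard_ball_le)

/-! ## §15 The near set and two-sided truncation -/

section Near

variable {Y : Set E3} {δ : ℝ}

/-- The points of a separated `Y` other than `p` within distance `R` of `p` form a finite set.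
[folklore] -/
theorem exists_finset_near (hδ : 0 < δ) (hsep : ∀ a ∈ Y, ∀ b ∈ Y, a ≠ b → δ ≤ dist a b)
    (p : E3) (R : ℝ) :
    ∃ F : Finset E3, ∀ q, q ∈ F ↔ q ∈ Y ∧ q ≠ p ∧ dist q p ≤ R := by
  classical
  have hfin := finite_sep_ball hδ hsep p R
  refine ⟨hfin.toFinset.filter fun q => q ≠ p, fun q => ?_⟩
  rw [Finset.mem_filter, Set.Finite.mem_toFinset]
  simp only [mem_setOf_eq]
  tauto

/-- **Lower truncation.** For a `δ`-separated `Y`, any centre `p`, a radius `R ≥ δ` and the near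
set `F = {q ∈ Y ∖ {p} : dist q p ≤ R}`:
`Σ_{q ∈ F} V_LJ(dist p q) − (1/6)·1024/(δ³R³) ≤ U_Y(p)` (part II, `sum_le_tsum_add_of_far`: the
dropped points are at distance `> R`). [folklore] -/
theorem sum_near_sub_tail_le_tsum (hδ : 0 < δ) (hsep : ∀ a ∈ Y, ∀ b ∈ Y, a ≠ b → δ ≤ dist a b)
    (p : E3) {R : ℝ} (hR : δ ≤ R) (F : Finset E3)
    (hF : ∀ q, q ∈ F ↔ q ∈ Y ∧ q ≠ p ∧ dist q p ≤ R) :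
    ∑ q ∈ F, lennardJones (dist p q) - 1 / 6 * (1024 / (δ ^ 3 * R ^ 3)) ≤
      ∑' q : {q : E3 // q ∈ Y ∧ q ≠ p}, lennardJones (dist p q.1) := by
  have h := sum_le_tsum_add_of_far hδ hsep p hR F (fun b hb => ⟨((hF b).1 hb).1, ((hF b).1 hb).2.1⟩)
    (fun b hb hbp hbF => by
      by_contra hlt
      exact hbF ((hF b).2 ⟨hb, hbp, (not_le.1 hlt).le⟩))
  linarith

/-- **Upper truncation.** For a `δ`-separated `Y ∋ p`, a radius `R ≥ 1` and the near set
`F = {q ∈ Y ∖ {p} : dist q p ≤ R}`: `U_Y(p) ≤ Σ_{q ∈ F} V_LJ(dist p q)` (the far terms are `≤ 0`;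
tree: `HullBulkOptimal.tsum_site_le_sum_near`). [folklore] -/
theorem tsum_le_sum_near (hδ : 0 < δ) (hsep : ∀ a ∈ Y, ∀ b ∈ Y, a ≠ b → δ ≤ dist a b)
    {p : E3} (hp : p ∈ Y) {R : ℝ} (hR : 1 ≤ R) (F : Finset E3)
    (hF : ∀ q, q ∈ F ↔ q ∈ Y ∧ q ≠ p ∧ dist q p ≤ R) :
    ∑' q : {q : E3 // q ∈ Y ∧ q ≠ p}, lennardJones (dist p q.1) ≤
      ∑ q ∈ F, lennardJones (dist p q) :=
  tsum_site_le_sum_near hδ hsep hp hR F hF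

/-- **Two-sided truncation error.** For `R ≥ max δ 1`:
`|U_Y(p) − Σ_{near} V_LJ| ≤ (1/6)·1024/(δ³R³)`. [folklore] -/
theorem abs_tsum_sub_sum_near_le (hδ : 0 < δ) (hsep : ∀ a ∈ Y, ∀ b ∈ Y, a ≠ b → δ ≤ dist a b)
    {p : E3} (hp : p ∈ Y) {R : ℝ} (hR : δ ≤ R) (hR1 : 1 ≤ R) (F : Finset E3)
    (hF : ∀ q, q ∈ F ↔ q ∈ Y ∧ q ≠ p ∧ dist q p ≤ R) :
    |∑' q : {q : E3 // q ∈ Y ∧ q ≠ p}, lennardJones (dist p q.1) -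
        ∑ q ∈ F, lennardJones (dist p q)| ≤ 1 / 6 * (1024 / (δ ^ 3 * R ^ 3)) := by
  rw [abs_le]
  constructor
  · linarith [sum_near_sub_tail_le_tsum hδ hsep p hR F hF]
  · have h0 : (0 : ℝ) ≤ 1 / 6 * (1024 / (δ ^ 3 * R ^ 3)) := by positivity
    linarith [tsum_le_sum_near hδ hsep hp hR1 F hF]

/-! ## §16 The single-site binding bound and the packing count -/

/-- A finite Lennard-Jones sum is at least `−(number of terms)/12` (`min V_LJ = V_LJ(1) = −1/12`).
[folklore] -/
theorem neg_card_div_le_sum_lennardJones (F : Finset E3) (f : E3 → ℝ) :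
    -(1 / 12 * (F.card : ℝ)) ≤ ∑ q ∈ F, lennardJones (f q) := by
  have h : ∑ q ∈ F, (-1 / 12 : ℝ) ≤ ∑ q ∈ F, lennardJones (f q) :=
    Finset.sum_le_sum fun q _ => neg_one_div_le_lennardJones (f q)
  rw [Finset.sum_const, nsmul_eq_mul] at h
  linarith

/-- **Single-site binding bound.** For a `δ`-separated `Y`, a centre `p`, `R ≥ δ` and the near set
`F = {q ∈ Y ∖ {p} : dist q p ≤ R}`: `−U_Y(p) ≤ #F/12 + (1/6)·1024/(δ³R³)` — every near term is
`≥ −1/12`, the far tail is `≥ −(1/6)·1024/(δ³R³)`. [folklore] -/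
theorem neg_tsum_le_card_add_tail (hδ : 0 < δ) (hsep : ∀ a ∈ Y, ∀ b ∈ Y, a ≠ b → δ ≤ dist a b)
    (p : E3) {R : ℝ} (hR : δ ≤ R) (F : Finset E3)
    (hF : ∀ q, q ∈ F ↔ q ∈ Y ∧ q ≠ p ∧ dist q p ≤ R) :
    -(∑' q : {q : E3 // q ∈ Y ∧ q ≠ p}, lennardJones (dist p q.1)) ≤
      1 / 12 * (F.card : ℝ) + 1 / 6 * (1024 / (δ ^ 3 * R ^ 3)) := by
  have h1 := sum_near_sub_tail_le_tsum hδ hsep p hR F hF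
  have h2 := neg_card_div_le_sum_lennardJones F fun q => dist p q
  linarith

/-- **Packing count of the near set.** For a `δ`-separated `Y ∋ p` and `R ≥ 0`:
`#{q ∈ Y ∖ {p} : dist q p ≤ R} ≤ (2R/δ + 1)³ − 1` (the tree's volume bound `ncard_ball_le` for the
ball about `p`, which also contains `p` itself). [folklore] -/
theorem card_near_le (hδ : 0 < δ) (hsep : ∀ a ∈ Y, ∀ b ∈ Y, a ≠ b → δ ≤ dist a b)
    {p : E3} (hp : p ∈ Y) {R : ℝ} (hR : 0 ≤ R) (F : Finset E3)
    (hF : ∀ q, q ∈ F ↔ q ∈ Y ∧ q ≠ p ∧ dist q p ≤ R) :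
    (F.card : ℝ) ≤ (2 * R / δ + 1) ^ 3 - 1 := by
  classical
  have hfin := finite_sep_ball hδ hsep p R
  have hpF : p ∉ F := fun h => ((hF p).1 h).2.1 rfl
  have hsub : insert p F ⊆ hfin.toFinset := by
    intro q hq
    rw [Set.Finite.mem_toFinset]
    rcases Finset.mem_insert.1 hq with rfl | hq
    · exact ⟨hp, by rw [dist_self]; exact hR⟩
    · exact ⟨((hF q).1 hq).1, ((hF q).1 hq).2.2⟩
  have hcard : F.card + 1 ≤ hfin.toFinset.card := by
    rw [← Finset.card_insert_of_notMem hpF]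
    exact Finset.card_le_card hsub
  have hball := ncard_ball_le hδ hsep p hR
  rw [Set.ncard_eq_toFinset_card _ hfin] at hball
  have : ((F.card + 1 : ℕ) : ℝ) ≤ (2 * R / δ + 1) ^ 3 := (Nat.cast_le.2 hcard).trans hball
  push_cast at this
  linarith

/-- **Closed form of the single-site bound.** For a `δ`-separated `Y ∋ p` and `R ≥ δ`:
`−U_Y(p) ≤ ((2R/δ + 1)³ − 1)/12 + (1/6)·1024/(δ³R³)`. [folklore] -/
theorem neg_tsum_le_packing_add_tail (hδ : 0 < δ)
    (hsep : ∀ a ∈ Y, ∀ b ∈ Y, a ≠ b → δ ≤ dist a b) {p : E3} (hp : p ∈ Y) {R : ℝ} (hR : δ ≤ R) :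
    -(∑' q : {q : E3 // q ∈ Y ∧ q ≠ p}, lennardJones (dist p q.1)) ≤
      1 / 12 * ((2 * R / δ + 1) ^ 3 - 1) + 1 / 6 * (1024 / (δ ^ 3 * R ^ 3)) := by
  obtain ⟨F, hF⟩ := exists_finset_near hδ hsep p R
  have h1 := neg_tsum_le_card_add_tail hδ hsep p hR F hF
  have h2 := card_near_le hδ hsep hp (hδ.le.trans hR) F hF
  nlinarith

end Near

/-! ## §17 Packing in a half-ball -/

section HalfBall

open Module

/-- **Packing bound by volume in a half-ball.** Finitely many `r`-separated points (`r > 0`) of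
`closedBall c R` lying in the closed half-space `{⟪x − c, u⟫ ≤ 0}` (`‖u‖ = 1`) number at most
`4 (R/r + 1)³`: the open `r/2`-balls about them are disjoint and contained in the open half-ball
`ball c' (R + r) ∩ {⟪x − c', u⟫ < 0}`, `c' = c + (r/2)u`, whose volume is half the ball's (point
reflection `x ↦ 2c' − x`). [folklore] -/
theorem card_le_half_of_separated (s : Finset E3) (c u : E3) (hu : ‖u‖ = 1) {r R : ℝ}
    (hr : 0 < r) (hR : 0 ≤ R) (hs : ∀ q ∈ s, dist q c ≤ R)
    (hhalf : ∀ q ∈ s, inner ℝ (q - c) u ≤ 0)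
    (h : ∀ a ∈ s, ∀ b ∈ s, a ≠ b → r ≤ dist a b) :
    (s.card : ℝ) ≤ 4 * (R / r + 1) ^ 3 := by
  set μ : Measure E3 := volume with hμ
  set ρ : ℝ := R + r with hρ
  set t : ℝ := r / 2 with ht
  set c' : E3 := c + t • u with hc'
  have tpos : 0 < t := by positivity
  have ρpos : 0 < ρ := by positivity
  -- the small balls
  set A : Set E3 := ⋃ q ∈ s, ball q t with hA
  have hdisj : Set.Pairwise (s : Set E3) (Function.onFun Disjoint fun q => ball q t) := by
    intro a ha b hb hab
    apply ball_disjoint_ball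
    have := h a ha b hb hab
    rw [ht]; linarith
  -- the two open half-balls about `c'`
  set Hm : Set E3 := ball c' ρ ∩ {x | inner ℝ (x - c') u < 0} with hHm
  set Hp : Set E3 := ball c' ρ ∩ {x | 0 < inner ℝ (x - c') u} with hHp
  have hcont : Continuous fun x : E3 => inner ℝ (x - c') u :=
    (continuous_id.sub continuous_const).inner continuous_const
  have hHm_meas : MeasurableSet Hm :=
    measurableSet_ball.inter (isOpen_lt hcont continuous_const).measurableSet
  have hHp_meas : MeasurableSet Hp :=
    measurableSet_ball.inter (isOpen_lt continuous_const hcont).measurableSet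
  have hcc' : dist c c' = t := by
    rw [hc', dist_eq_norm, sub_add_cancel_left, norm_neg, norm_smul, hu, mul_one,
      Real.norm_eq_abs, abs_of_pos tpos]
  -- the small balls lie in the lower half-ball
  have hAHm : A ⊆ Hm := by
    intro x hx
    rw [hA, mem_iUnion₂] at hx
    obtain ⟨q, hq, hxq⟩ := hx
    rw [mem_ball] at hxq
    constructor
    · rw [mem_ball]
      calc dist x c' ≤ dist x q + dist q c + dist c c' := dist_triangle4 x q c c'
        _ < t + R + t := by linarith [hs q hq]
        _ = ρ := by rw [hρ, ht]; ring
    · show inner ℝ (x - c') u < 0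
      have hx' : x - c' = (x - q) + (q - c) - t • u := by rw [hc']; abel
      rw [hx', inner_sub_left, inner_add_left, real_inner_smul_left, real_inner_self_eq_norm_sq, hu]
      have h1 : inner ℝ (x - q) u ≤ ‖x - q‖ := by
        have := real_inner_le_norm (x - q) u
        rwa [hu, mul_one] at this
      have h2 : ‖x - q‖ < t := by rwa [← dist_eq_norm]
      have h3 := hhalf q hq
      nlinarith
  -- the two half-balls are disjoint, inside the ball, and of equal volume
  have hdisj2 : Disjoint Hm Hp := by
    rw [Set.disjoint_left]
    rintro x ⟨-, h1⟩ ⟨-, h2⟩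
    simp only [mem_setOf_eq] at h1 h2
    exact lt_asymm h1 h2
  have hunion : Hm ∪ Hp ⊆ ball c' ρ := union_subset inter_subset_left inter_subset_left
  have hpre : Hm = Neg.neg ⁻¹' ((fun x => x + (2 : ℝ) • c') ⁻¹' Hp) := by
    ext x
    simp only [hHm, hHp, mem_preimage, mem_inter_iff, mem_ball, mem_setOf_eq]
    have e1 : -x + (2 : ℝ) • c' - c' = -(x - c') := by
      rw [two_smul]; abel
    have e2 : dist (-x + (2 : ℝ) • c') c' = dist x c' := by
      rw [dist_eq_norm, dist_eq_norm, e1, norm_neg]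
    rw [e2, e1, inner_neg_left, neg_pos]
  have hμeq : μ Hm = μ Hp := by
    rw [hpre, Measure.measure_preimage_neg, measure_preimage_add_right]
  have htwo : 2 * μ Hm ≤ μ (ball c' ρ) := by
    rw [two_mul]
    nth_rewrite 2 [hμeq]
    rw [← measure_union hdisj2 hHp_meas]
    exact measure_mono hunion
  -- volumes
  have hd : Module.finrank ℝ E3 = 3 := finrank_euclideanSpace_fin
  have hA_vol : μ A = (s.card : ℝ≥0∞) * (ENNReal.ofReal (t ^ 3) * μ (ball 0 1)) := by
    rw [hA, measure_biUnion_finset hdisj fun q _ => measurableSet_ball]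
    simp only [Measure.addHaar_ball_of_pos μ _ tpos, hd, Finset.sum_const, nsmul_eq_mul]
  have hball_vol : μ (ball c' ρ) = ENNReal.ofReal (ρ ^ 3) * μ (ball 0 1) := by
    rw [Measure.addHaar_ball_of_pos μ _ ρpos, hd]
  have I : 2 * ((s.card : ℝ≥0∞) * ENNReal.ofReal (t ^ 3)) * μ (ball 0 1) ≤
      ENNReal.ofReal (ρ ^ 3) * μ (ball 0 1) := by
    calc 2 * ((s.card : ℝ≥0∞) * ENNReal.ofReal (t ^ 3)) * μ (ball 0 1) = 2 * μ A := by
          rw [hA_vol]; ring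
      _ ≤ 2 * μ Hm := by gcongr
      _ ≤ μ (ball c' ρ) := htwo
      _ = ENNReal.ofReal (ρ ^ 3) * μ (ball 0 1) := hball_vol
  have J : 2 * ((s.card : ℝ≥0∞) * ENNReal.ofReal (t ^ 3)) ≤ ENNReal.ofReal (ρ ^ 3) :=
    (ENNReal.mul_le_mul_iff_left (measure_ball_pos μ _ zero_lt_one).ne'
      measure_ball_lt_top.ne).1 I
  have K : 2 * ((s.card : ℝ) * t ^ 3) ≤ ρ ^ 3 := by
    have e : 2 * ((s.card : ℝ≥0∞) * ENNReal.ofReal (t ^ 3)) =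
        ENNReal.ofReal (2 * ((s.card : ℝ) * t ^ 3)) := by
      rw [ENNReal.ofReal_mul (by norm_num : (0 : ℝ) ≤ 2), ENNReal.ofReal_mul (Nat.cast_nonneg _),
        ENNReal.ofReal_natCast, ENNReal.ofReal_ofNat]
    rw [e] at J
    exact (ENNReal.ofReal_le_ofReal_iff (by positivity)).1 J
  -- `2 · #s · (r/2)³ ≤ (R + r)³` is `#s ≤ 4 (R/r + 1)³`
  have ht3 : 0 < t ^ 3 := pow_pos tpos 3
  have hkey : (s.card : ℝ) ≤ ρ ^ 3 / (2 * t ^ 3) := by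
    rw [le_div_iff₀ (by positivity)]; linarith
  have hq : ρ ^ 3 / (2 * t ^ 3) = 4 * (R / r + 1) ^ 3 := by
    rw [hρ, ht]
    field_simp
    ring
  linarith [hq ▸ hkey]

variable {Y : Set E3} {δ : ℝ}

/-- **Packing count of the near set at the top site of a half-space configuration.** For a
`δ`-separated `Y ⊆ {⟪·, u⟫ ≤ 0}` (`‖u‖ = 1`) containing `0` and `R ≥ 0`:
`#{q ∈ Y ∖ {0} : dist q 0 ≤ R} ≤ 4 (R/δ + 1)³ − 1` (`card_le_half_of_separated` applied to the near
set together with `0`). [folklore] -/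
theorem card_near_le_half {u : E3} (hu : ‖u‖ = 1) (hδ : 0 < δ)
    (hsep : ∀ a ∈ Y, ∀ b ∈ Y, a ≠ b → δ ≤ dist a b) (h0 : (0 : E3) ∈ Y)
    (hhalf : ∀ q ∈ Y, inner ℝ q u ≤ 0) {R : ℝ} (hR : 0 ≤ R) (F : Finset E3)
    (hF : ∀ q, q ∈ F ↔ q ∈ Y ∧ q ≠ 0 ∧ dist q 0 ≤ R) :
    (F.card : ℝ) ≤ 4 * (R / δ + 1) ^ 3 - 1 := by
  classical
  have hpF : (0 : E3) ∉ F := fun h => ((hF 0).1 h).2.1 rfl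
  have hmem : ∀ q ∈ insert (0 : E3) F, q ∈ Y ∧ dist q 0 ≤ R := by
    intro q hq
    rcases Finset.mem_insert.1 hq with rfl | hq
    · exact ⟨h0, by rw [dist_self]; exact hR⟩
    · exact ⟨((hF q).1 hq).1, ((hF q).1 hq).2.2⟩
  have h := card_le_half_of_separated (insert (0 : E3) F) 0 u hu hδ hR
    (fun q hq => (hmem q hq).2) (fun q hq => by rw [sub_zero]; exact hhalf q (hmem q hq).1)
    (fun a ha b hb hab => hsep a (hmem a ha).1 b (hmem b hb).1 hab)
  rw [Finset.card_insert_of_notMem hpF] at h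
  push_cast at h
  linarith

/-- **Single-site bound at the top site of a half-space configuration.** For a `δ`-separated
`Y ⊆ {⟪·, u⟫ ≤ 0}` (`‖u‖ = 1`) containing `0` and `R ≥ δ`:
`−U_Y(0) ≤ (4(R/δ + 1)³ − 1)/12 + (1/6)·1024/(δ³R³)`. [folklore] -/
theorem neg_tsum_top_le_half_packing_add_tail {u : E3} (hu : ‖u‖ = 1) (hδ : 0 < δ)
    (hsep : ∀ a ∈ Y, ∀ b ∈ Y, a ≠ b → δ ≤ dist a b) (h0 : (0 : E3) ∈ Y)
    (hhalf : ∀ q ∈ Y, inner ℝ q u ≤ 0) {R : ℝ} (hR : δ ≤ R) :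
    -(∑' q : {q : E3 // q ∈ Y ∧ q ≠ 0}, lennardJones (dist 0 q.1)) ≤
      1 / 12 * (4 * (R / δ + 1) ^ 3 - 1) + 1 / 6 * (1024 / (δ ^ 3 * R ^ 3)) := by
  obtain ⟨F, hF⟩ := exists_finset_near hδ hsep (0 : E3) R
  have h1 := neg_tsum_le_card_add_tail hδ hsep 0 hR F hF
  have h2 := card_near_le_half hu hδ hsep h0 hhalf (hδ.le.trans hR) F hF
  nlinarith

end HalfBall

/-! ## Registered sub-goal of `stub_noThickHalfSpaceBinding`: the single-site split bound -/

/-- **Sub-goal `stub_nhb_siteBindingSplit` of the stub `stub_noThickHalfSpaceBinding`** (registered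
on stmt-AtomisticToContinuum-15099): for a `δ`-separated `Y ⊆ ℝ³`, a centre `p`, a radius `R ≥ δ`
and the near set `F = {q ∈ Y ∖ {p} : dist q p ≤ R}`,
`−(#F/12 + (1/6)·1024/(δ³R³)) ≤ U_Y(p)` (`neg_tsum_le_card_add_tail` in arrow form). [folklore] -/
theorem stub_nhb_siteBindingSplit :
    ∀ (Y : Set (EuclideanSpace ℝ (Fin 3))) (δ : ℝ), 0 < δ →
      (∀ p ∈ Y, ∀ q ∈ Y, p ≠ q → δ ≤ dist p q) →
      ∀ (p : EuclideanSpace ℝ (Fin 3)) (R : ℝ), δ ≤ R →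
      ∀ F : Finset (EuclideanSpace ℝ (Fin 3)),
        (∀ q, q ∈ F ↔ q ∈ Y ∧ q ≠ p ∧ dist q p ≤ R) →
        -(1 / 12 * (F.card : ℝ) + 1 / 6 * (1024 / (δ ^ 3 * R ^ 3))) ≤
          ∑' q : {q : EuclideanSpace ℝ (Fin 3) // q ∈ Y ∧ q ≠ p}, lennardJones (dist p q.1) := by
  intro Y δ hδ hsep p R hR F hF
  have := neg_tsum_le_card_add_tail hδ hsep p hR F hF
  linarith

end Summit.AtomisticToContinuum.Crystallization.Theorems.PerronTransitivityUniformBindingRigidity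

end
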